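import Summits.CriticalPhenomena.PercolationContinuityZ3.Theorems.Transplant.SkelNegBParamsResidualsA
import Summits.CriticalPhenomena.PercolationContinuityZ3.Theorems.Transplant.SkelNegBParamsBridgeF
import HarnessLib

/-!
# N1 params (ζ′) — **THE RESIDUAL ABSORBING THE y′-FACE BRIDGE's KIT RADIUS**: `RBF c mk := R(scale t (MBF c mk) (nBF c mk))` (the prism radius of the
# wide pair at slot `c`, an ex-free function of `M_u, c, RA′` and the Step-I data — `D.R` is arbitrary and `D.scale` is not monotone, so it is NOT dominated
# by `Rl`/`Rb` and must be absorbed), and **`exAF c := exA + (r₀A 0 (RBF c 0) + 1)`** with `exA ≤ exAF c` and EXACTLY the layer-(b) glue's floor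
# `hex : exA ≤ ex ∧ r₀A 0 (R (scale t (MBF c 0) (nBF c 0))) + 1 ≤ ex` at `ex := exAF c` (**`hex_exAF`**), plus `floors_exA`'s conjuncts transported (**`floors_exAF`**).
# Slot-ledger consequence (proposal v2, stmt-g16 2026-08-22T08:20Z, answering p5-g12 07:44:22Z / p3-g12 07:59:39Z (4)): `Sv := SUA (exAF c) mx` in place of
# `SUA exA mx`; (R)'s x-family is served by its general form `rootOblTWAt_negBTA_x_ex (ex := exAF c)` with `hfloors := floors_exAF`, the y-family needs the same
# one-line generalisation; (C) has the general `hex` form.  builds on p205010 (kernel theorem, internal audit signed; external expert review pending) — nothing in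
# this file uses p205010; NOTHING is claimed about the node `SamePDropOfSkeletonNeg₁` (OPEN); definitions + arithmetic only.
Lane `prim-bschramm-*`, seat `prim-bschramm-stmt` (gen 16); helper file (`--supports stmt-CriticalPhenomena-4575 --as helper`).
[cite: KozmaNitzan2024, §4 Lemma 12 (pp. 23–25)] [cite: MartineauTassion2017, §3.1]
-/

noncomputable section

open scoped Classical

namespace Summit.CriticalPhenomena.PercolationContinuityZ3.Theorems.Transplant

namespace PlanarSkeletonNeg

namespace NegB

open Literature.Probability.Percolation Literature.Probability.LatticeModels SimpleGraph
open SkelConc (Consts)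
open Skelφ (shearUnit)
open Skelφ.StepI (DataN)
open Neg

namespace KS

section RBF

variable (κ : Consts) {V : Type} [Countable V] {G : SimpleGraph V} [G.LocallyFinite] (Φ : PlanarSkeletonNeg G) (t : V)
  (p : unitInterval) (D : DataN V) (c mk : ℕ)

/-- **The y′-face bridge's kit radius** `RBF c mk := R(scale t MBF nBF)`. [this work] -/
def RBF : ℕ := D.R (D.scale t (MBF κ Φ t p D c mk) (nBF κ Φ t p D c mk))

/-- `RBF` unfolds by `rfl`. [folklore] -/
theorem RBF_eq : RBF κ Φ t p D c mk = D.R (D.scale t (MBF κ Φ t p D c mk) (nBF κ Φ t p D c mk)) := rfl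

end RBF

end KS

/-- **THE (ζ′) RESIDUAL WITH THE y′-FACE BRIDGE ABSORBED** `exAF c := exA + (r₀A 0 (RBF c 0) + 1)`. [this work] -/
def exAF (c : ℕ) : GSlot := fun κ _ _ _ _ _ Φ t p D g f => exA κ Φ t p D g f + (KS.r₀A Φ t D 0 (KS.RBF κ Φ t p D c 0) + 1)

section Facts

variable (κ : Consts) {V : Type} [DecidableEq V] [Countable V] {G : SimpleGraph V} [G.LocallyFinite] (Φ : PlanarSkeletonNeg G) (t : V)
  (p : unitInterval) (D : DataN V) (c g f : ℕ)

/-- `exAF c = exA + (r₀A 0 (RBF c 0) + 1)` (by `rfl`) and `exA ≤ exAF c`. [folklore] -/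
theorem exAF_eq : exAF c κ Φ t p D g f = exA κ Φ t p D g f + (KS.r₀A Φ t D 0 (KS.RBF κ Φ t p D c 0) + 1) ∧ exA κ Φ t p D g f ≤ exAF c κ Φ t p D g f :=
  ⟨rfl, Nat.le_add_right _ _⟩

/-- **The layer-(b) glue's `hex` at `ex := exAF c`**: `exA ≤ exAF c` and `r₀A 0 (R (scale t (MBF c 0) (nBF c 0))) + 1 ≤ exAF c`. [folklore] -/
theorem hex_exAF : exA κ Φ t p D g f ≤ exAF c κ Φ t p D g f ∧
    KS.r₀A Φ t D 0 (D.R (D.scale t (KS.MBF κ Φ t p D c 0) (KS.nBF κ Φ t p D c 0))) + 1 ≤ exAF c κ Φ t p D g f :=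
  ⟨Nat.le_add_right _ _, Nat.le_add_left _ _⟩

/-- **`floors_exA` transported to `exAF c`** (same nine conjuncts). [folklore] -/
theorem floors_exAF :
    KS.r₀A Φ t D 0 (Rb κ Φ t p D) + 1 ≤ exAF c κ Φ t p D g f ∧ KS.r₀A Φ t D 0 (Rl κ Φ t p D g f) + 1 ≤ exAF c κ Φ t p D g f ∧
    Rl κ Φ t p D g f + 1 ≤ exAF c κ Φ t p D g f ∧ Rb κ Φ t p D + 1 ≤ exAF c κ Φ t p D g f ∧
    Yb κ Φ t p D g f + 1000 * shearUnit (nL κ Φ t p D g f) (hL κ Φ t p D g f) + 1 ≤ exAF c κ Φ t p D g f ∧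
    exC κ Φ t p D g f ≤ exAF c κ Φ t p D g f ∧ KS.RlevA κ Φ t p D 0 + KS.reachA t D 0 ≤ exAF c κ Φ t p D g f ∧
    KS.r₀A Φ t D 0 (Rl κ Φ t p D g f) ≤ exAF c κ Φ t p D g f ∧ Yb κ Φ t p D g f + 11055 * nL κ Φ t p D g f + 1000 * ℓL κ Φ t p D g f + 20 ≤ exAF c κ Φ t p D g f := by
  obtain ⟨h1, h2, h3, h4, h5, h6, h7, h8, h9⟩ := floors_exA κ Φ t p D g f
  have h := (exAF_eq κ Φ t p D c g f).2
  exact ⟨h1.trans h, h2.trans h, h3.trans h, h4.trans h, h5.trans h, h6.trans h, h7.trans h, h8.trans h, h9.trans h⟩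

/-- `exR2 ≤ exAF c` and `exCA ≤ exAF c` (`exR2_le_exA` transported). [folklore] -/
theorem exR2_le_exAF : exR2 κ Φ t p D g f ≤ exAF c κ Φ t p D g f ∧ exCA κ Φ t p D g f ≤ exAF c κ Φ t p D g f := by
  obtain ⟨h1, h2⟩ := exR2_le_exA κ Φ t p D g f
  have h := (exAF_eq κ Φ t p D c g f).2
  exact ⟨h1.trans h, h2.trans h⟩

end Facts

end NegB

end PlanarSkeletonNeg

end Summit.CriticalPhenomena.PercolationContinuityZ3.Theorems.Transplant

end
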